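import Mathlib
import HarnessLib
import Summits.NavierStokesRegularity.NavierStokesRegularity.Theorems.QuarterLogPincerHelmholtzCentreDefs
import Literature.Analysis.FluidPDE.LocalBiotSavartHelmholtz
import Literature.Analysis.FluidPDE.LocalAffineChainRules
import Literature.Analysis.FluidPDE.WholeSpaceIBP

/-!
# Route `QuarterLogPincer`, crux `TypeIQuantSubcubicExp` (stmt-NavierStokesRegularity-24077), line `vortical_centre` —
# tools for H2♭ `ShellKernelBound`: scale-invariant cutoff and shell kernel bounds (STUB-PLAN parts T1, T2)

Parts T1/T2 of the typed plan `pub-ns-dss/typer/STUB-PLAN-ShellKernelBound.md` (typer g38) for the ONE open potential-theory stub H2♭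
`HelmholtzCentre.ShellKernelBound` of ns-idea-7's line `vortical_centre` (v1.2): the integrand of the Green remainder
`∫ Γ(y−z) G(z) dz` lives on the shell `2R/3 ≤ ‖z − y‖ ≤ R` of the cutoff `χ = ballCutoff y (R/3)`, where

* T1 `exists_abs_laplacian_ballCutoff_le` — `|Δ(ballCutoff c r)(y)| ≤ C₂ / r²` with an ABSOLUTE `C₂` (scaling `ballCutoff_eq_scale` + the affine
  chain rule `laplacian_comp_affine_of_contDiffOn`; companion of the tree's gradient bound `exists_norm_fderiv_ballCutoff_le`), and
  `fderiv_ballCutoff_eq_zero_of_mem_ball` / `laplacian_ballCutoff_eq_zero_of_mem_ball` / `…_of_not_mem_closedBall` (the derivatives vanish off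
  the shell);
* T2 `norm_newtonKernel_le_of_le_norm`, `norm_fderiv_newtonKernel_le_of_le_norm` — `‖Γ(w)‖ ≤ (4πa)⁻¹`, `‖DΓ(w)‖ ≤ (4πa²)⁻¹` for `a ≤ ‖w‖`, `0 < a`.

HONEST FRAME: calculus of a fixed smooth cutoff and of the Newtonian kernel; bricks toward one registered stub; nothing here bears on Sb, the crux,
W7 or Navier–Stokes regularity (OPEN / not proved).  pub-ns-dss typer (g38), `--supports stmt-NavierStokesRegularity-24077`.
-/

noncomputable section

set_option linter.dupNamespace false

namespace Summit.NavierStokesRegularity.NavierStokesRegularity.Cruxes.TypeIQuantSubcubicExp.HelmholtzCentre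

open MeasureTheory Set Function Filter Topology Metric
open scoped ENNReal NNReal Laplacian RealInnerProductSpace
open Literature.Analysis Literature.Analysis.FluidPDE

/-! ### T1 — the cutoff: scale-invariant Laplacian bound and vanishing off the shell -/

/-- **Scale-invariant Laplacian bound for the ball cutoff**: there is an absolute `C₂ ≥ 0` with `|Δ(ballCutoff c r)(y)| ≤ C₂ / r²`
for all `c`, `r > 0`, `y` (`ballCutoff c r = θ(r⁻¹(· − c))`, `θ = radialCutoff 2 3` smooth with compact support). -/
theorem exists_abs_laplacian_ballCutoff_le :
    ∃ C₂ : ℝ, 0 ≤ C₂ ∧ ∀ (c : EuclideanSpace ℝ (Fin 3)) (r : ℝ), 0 < r →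
      ∀ y : EuclideanSpace ℝ (Fin 3), |(Δ (ballCutoff c r)) y| ≤ C₂ / r ^ 2 := by
  set θ : EuclideanSpace ℝ (Fin 3) → ℝ := radialCutoff 2 3 with hθ
  have hθs : ContDiff ℝ 2 θ := radialCutoff_contDiff 2 3
  have hθc : HasCompactSupport θ := hasCompactSupport_radialCutoff (by norm_num) (by norm_num)
  have hΔc : Continuous (Δ θ) := (contDiff_laplacian (n := 0) (by exact hθs)).continuous
  have hΔs : HasCompactSupport (Δ θ) :=
    HasCompactSupport.of_support_subset_isCompact hθc.isCompact fun y hy => by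
      by_contra h
      exact hy (laplacian_eq_zero_of_notMem_tsupport h)
  obtain ⟨C, hC⟩ := hΔc.bounded_above_of_compact_support hΔs
  refine ⟨max C 0, le_max_right _ _, fun c r hr y => ?_⟩
  have hfun : ballCutoff c r = fun y => θ ((-r⁻¹) • c + r⁻¹ • y) := by
    funext y
    rw [ballCutoff_eq_scale hr y, hθ, smul_sub, neg_smul]
    abel_nf
  have hΔ := laplacian_comp_affine_of_contDiffOn (hθs.contDiffOn (s := univ)) isOpen_univ ((-r⁻¹) • c) r⁻¹
    (y := y) (mem_univ _)
  rw [hfun, hΔ, smul_eq_mul, abs_mul, abs_of_nonneg (sq_nonneg _), inv_pow, ← div_eq_inv_mul]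
  exact div_le_div_of_nonneg_right ((hC _).trans (le_max_left _ _)) (by positivity)

/-- Inside `B(c, 2r)` the cutoff is locally `1`: its derivative vanishes. -/
theorem fderiv_ballCutoff_eq_zero_of_mem_ball {c : EuclideanSpace ℝ (Fin 3)} {r : ℝ} (hr : 0 < r)
    {y : EuclideanSpace ℝ (Fin 3)} (hy : y ∈ ball c (2 * r)) : fderiv ℝ (ballCutoff c r) y = 0 := by
  rw [(ballCutoff_eventuallyEq_one hr hy).fderiv_eq]
  exact fderiv_const_apply _

/-- Inside `B(c, 2r)` the Laplacian of the cutoff vanishes. -/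
theorem laplacian_ballCutoff_eq_zero_of_mem_ball {c : EuclideanSpace ℝ (Fin 3)} {r : ℝ} (hr : 0 < r)
    {y : EuclideanSpace ℝ (Fin 3)} (hy : y ∈ ball c (2 * r)) : (Δ (ballCutoff c r)) y = 0 := by
  rw [(InnerProductSpace.laplacian_congr_nhds (ballCutoff_eventuallyEq_one hr hy)).eq_of_nhds]
  simp

/-- Off `B̄(c, 3r)` the cutoff is locally `0`: its derivative vanishes. -/
theorem fderiv_ballCutoff_eq_zero_of_not_mem_closedBall {c : EuclideanSpace ℝ (Fin 3)} {r : ℝ} (hr : 0 < r)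
    {y : EuclideanSpace ℝ (Fin 3)} (hy : y ∉ closedBall c (3 * r)) : fderiv ℝ (ballCutoff c r) y = 0 := by
  rw [(ballCutoff_eventuallyEq_zero hr hy).fderiv_eq]
  exact fderiv_const_apply _

/-- Off `B̄(c, 3r)` the Laplacian of the cutoff vanishes. -/
theorem laplacian_ballCutoff_eq_zero_of_not_mem_closedBall {c : EuclideanSpace ℝ (Fin 3)} {r : ℝ} (hr : 0 < r)
    {y : EuclideanSpace ℝ (Fin 3)} (hy : y ∉ closedBall c (3 * r)) : (Δ (ballCutoff c r)) y = 0 := by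
  rw [(InnerProductSpace.laplacian_congr_nhds (ballCutoff_eventuallyEq_zero hr hy)).eq_of_nhds]
  simp

/-! ### T2 — the Newtonian kernel on the shell -/

/-- `‖Γ(w)‖ ≤ (4πa)⁻¹` when `0 < a ≤ ‖w‖` (`Γ(w) = −(4π‖w‖)⁻¹`). -/
theorem norm_newtonKernel_le_of_le_norm {a : ℝ} (ha : 0 < a) {w : EuclideanSpace ℝ (Fin 3)} (hw : a ≤ ‖w‖) :
    ‖newtonKernel w‖ ≤ (4 * Real.pi * a)⁻¹ := by
  have hw0 : 0 < ‖w‖ := ha.trans_le hw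
  have h4 : 0 < 4 * Real.pi * ‖w‖ := mul_pos (by positivity) hw0
  rw [newtonKernel_eq, norm_neg, norm_inv, Real.norm_eq_abs, abs_of_pos h4]
  exact inv_anti₀ (by positivity) (by nlinarith [Real.pi_pos])

/-- `‖DΓ(w)‖ ≤ (4πa²)⁻¹` when `0 < a ≤ ‖w‖` (`‖DΓ(w)‖ ≤ (4π‖w‖²)⁻¹`, tree `norm_fderiv_newtonKernel_le`). -/
theorem norm_fderiv_newtonKernel_le_of_le_norm {a : ℝ} (ha : 0 < a) {w : EuclideanSpace ℝ (Fin 3)} (hw : a ≤ ‖w‖) :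
    ‖fderiv ℝ newtonKernel w‖ ≤ (4 * Real.pi * a ^ 2)⁻¹ := by
  refine (norm_fderiv_newtonKernel_le w).trans (inv_anti₀ (by positivity) ?_)
  have h : a ^ 2 ≤ ‖w‖ ^ 2 := pow_le_pow_left₀ ha.le hw 2
  nlinarith [Real.pi_pos]

/-- On the shell of `χ = ballCutoff y (R/3)` (`2R/3 ≤ ‖z − y‖`): `‖Γ(y − z)‖ ≤ 3/(8πR)` and `‖DΓ(y − z)‖ ≤ 9/(16πR²)`. -/
theorem newtonKernel_shell_bounds {R : ℝ} (hR : 0 < R) {y z : EuclideanSpace ℝ (Fin 3)} (hz : 2 * R / 3 ≤ ‖z - y‖) :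
    ‖newtonKernel (y - z)‖ ≤ 3 / (8 * Real.pi * R) ∧ ‖fderiv ℝ newtonKernel (y - z)‖ ≤ 9 / (16 * Real.pi * R ^ 2) := by
  have ha : 0 < 2 * R / 3 := by positivity
  have hw : 2 * R / 3 ≤ ‖y - z‖ := by rwa [norm_sub_rev]
  refine ⟨(norm_newtonKernel_le_of_le_norm ha hw).trans (le_of_eq ?_),
    (norm_fderiv_newtonKernel_le_of_le_norm ha hw).trans (le_of_eq ?_)⟩
  · field_simp
    ring
  · field_simp
    ring

end Summit.NavierStokesRegularity.NavierStokesRegularity.Cruxes.TypeIQuantSubcubicExp.HelmholtzCentre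

end
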